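import Summits.QuantumFields.YangMills.Theorems.SqueezedSkewnessTorusKLMixtureAlgebra
import Mathlib.Analysis.InnerProductSpace.PiL2
import HarnessLib

/-!
# Route `SqueezedSkewness`, crux `SpectralIdentificationL` (stmt-QuantumFields-22796), stub `stub_osData` — OS-DATA layer (O1):
# BLOCK-DIAGONAL OPERATORS ON A FINITE HILBERT DIRECT SUM

Pure Hilbert-space algebra (generic complex inner-product space `H`, finite index type `ι`; theorems only).  On the Hilbert direct
sum `PiLp 2 (fun _ : ι => H) = ⊕_{i ∈ ι} H`:

* `exists_blockDiag` — given blocks `Q i` (self-adjoint, compact, positive contractions) and commuting norm-preserving representations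
  `V i` of an additive monoid `X`, the block-diagonal operators `P = ⊕ Q i`, `U x = ⊕ V i x` have the same properties
  (`IsSelfAdjoint`, `IsCompactOperator` by Tychonoff, `Re ⟪P v, v⟫ ≥ 0`, `‖P v‖ ≤ ‖v‖`, `U 0 = 1`, `U (x+y) = U x U y`, `‖U x v‖ = ‖v‖`,
  `P U = U P`) and act componentwise: `(Pⁿ (U x Ψ)) i = (Q i)ⁿ (V i x (Ψ i))`;
* `norm_sq_sum_smul_blocks` — `‖Σ_a c_a • P^{n_a} U(x_a) Ψ‖² = Σ_i ‖Σ_a c_a • (Q i)^{n_a} V i (x_a) (Ψ i)‖²`;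
* `rankOne_block` — the rank-one projection `v ↦ ⟪u, v⟫ u` onto a unit vector is an admissible block (self-adjoint, compact, positive
  contraction fixing `u`), used downstream for the VARIANCE ATOM of the thermal limit.

This is the packaging step of the thermodynamic limit of the torus Källén–Lehmann mixture (the top eigenspace of the transfer operator may
be degenerate for a general compact gauge group, so the limit state is a finite mixture, realised as ONE vector state on a direct sum).
Seat `ym-line-fcl-p3` g17 (cell ym-idea-1; free hands); Mathlib + the generic layer `…TorusKLMixtureAlgebra` only; nothing about a summit,
NT or the mass gap is proved here.  [folklore]
References: M. Reed, B. Simon, *Methods of Modern Mathematical Physics I* (1980), §II.1, Thm VI.12 [cite: ReedSimonI1980, §II.1].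
-/

set_option autoImplicit false

noncomputable section

open scoped InnerProductSpace ComplexConjugate BigOperators
open Filter Topology

namespace Summit.QuantumFields.YangMills.Theorems.OSData.BlockDiagonal

open Summit.QuantumFields.YangMills.Theorems.TorusKL

variable {ι : Type*} [Fintype ι] {H : Type*} [NormedAddCommGroup H] [InnerProductSpace ℂ H]

/-! ## §1 Compactness of a product of compact operators (Tychonoff) -/

omit [Fintype ι] in
/-- A coordinatewise product of compact operators is a compact operator on the product space (finite index). [cite: ReedSimonI1980, Thm VI.12] -/
theorem isCompactOperator_piMap [Finite ι] (Q : ι → H →L[ℂ] H) (hQc : ∀ i, IsCompactOperator (Q i)) :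
    IsCompactOperator (ContinuousLinearMap.piMap Q : (ι → H) →L[ℂ] (ι → H)) := by
  choose K hK hKn using hQc
  rw [isCompactOperator_iff_exists_mem_nhds_image_subset_compact]
  refine ⟨{v : ι → H | ∀ i, Q i (v i) ∈ K i}, ?_, Set.pi Set.univ K, isCompact_univ_pi hK, ?_⟩
  · have hset : {v : ι → H | ∀ i, Q i (v i) ∈ K i} = ⋂ i, (fun v : ι → H => v i) ⁻¹' (Q i ⁻¹' K i) := by
      ext v; simp
    rw [hset]
    refine (Filter.iInter_mem).2 fun i => ?_
    have hc : ContinuousAt (fun v : ι → H => v i) 0 := (continuous_apply i).continuousAt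
    have h0 : Q i ⁻¹' K i ∈ 𝓝 ((fun v : ι → H => v i) 0) := by simpa using hKn i
    exact hc.preimage_mem_nhds h0
  · rintro _ ⟨v, hv, rfl⟩
    simp only [ContinuousLinearMap.coe_piMap', Set.mem_pi, Set.mem_univ, forall_const]
    exact fun i => hv i

/-! ## §2 The block-diagonal package -/

variable [CompleteSpace H]

set_option maxHeartbeats 800000 in
/-- ★ **Block-diagonal operators on `⊕_{i ∈ ι} H`.**  Blocks `Q i` (self-adjoint, compact, positive contractions) and commuting
norm-preserving representations `V i` of an additive monoid give block-diagonal `P`, `U` with the same properties, acting componentwise: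
`(Pⁿ (U x Ψ)) i = (Q i)ⁿ (V i x (Ψ i))`. [cite: ReedSimonI1980, §II.1] -/
theorem exists_blockDiag {X : Type*} [AddMonoid X] (Q : ι → H →L[ℂ] H) (V : ι → X → H →L[ℂ] H)
    (hQsa : ∀ i, IsSelfAdjoint (Q i)) (hQc : ∀ i, IsCompactOperator (Q i))
    (hQpos : ∀ i v, 0 ≤ RCLike.re ⟪Q i v, v⟫_ℂ) (hQn : ∀ i v, ‖Q i v‖ ≤ ‖v‖)
    (hV0 : ∀ i, V i 0 = 1) (hVadd : ∀ i x y, V i (x + y) = V i x * V i y)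
    (hVnorm : ∀ i x v, ‖V i x v‖ = ‖v‖) (hQV : ∀ i x, Q i * V i x = V i x * Q i) :
    ∃ (P : PiLp 2 (fun _ : ι => H) →L[ℂ] PiLp 2 (fun _ : ι => H))
      (U : X → PiLp 2 (fun _ : ι => H) →L[ℂ] PiLp 2 (fun _ : ι => H)),
      IsSelfAdjoint P ∧ IsCompactOperator P ∧ (∀ v, 0 ≤ RCLike.re ⟪P v, v⟫_ℂ) ∧ (∀ v, ‖P v‖ ≤ ‖v‖) ∧
      U 0 = 1 ∧ (∀ x y, U (x + y) = U x * U y) ∧ (∀ x v, ‖U x v‖ = ‖v‖) ∧ (∀ x, P * U x = U x * P) ∧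
      ∀ (n : ℕ) (x : X) (Ψ : PiLp 2 (fun _ : ι => H)) (i : ι), ((P ^ n) (U x Ψ)) i = (Q i ^ n) (V i x (Ψ i)) := by
  classical
  obtain ⟨eL, heL⟩ : ∃ eL : PiLp 2 (fun _ : ι => H) ≃L[ℂ] (ι → H), eL = PiLp.continuousLinearEquiv 2 ℂ (fun _ : ι => H) :=
    ⟨_, rfl⟩
  have heLa : ∀ v, eL v = WithLp.ofLp v := fun v => by rw [heL]; rfl
  have heLs : ∀ w, eL.symm w = WithLp.toLp 2 w := fun w => by rw [heL]; rfl
  obtain ⟨P, hP⟩ : ∃ P : PiLp 2 (fun _ : ι => H) →L[ℂ] PiLp 2 (fun _ : ι => H),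
      P = (eL.symm : (ι → H) →L[ℂ] PiLp 2 (fun _ : ι => H)) ∘L (ContinuousLinearMap.piMap Q) ∘L
        (eL : PiLp 2 (fun _ : ι => H) →L[ℂ] (ι → H)) := ⟨_, rfl⟩
  obtain ⟨U, hU⟩ : ∃ U : X → PiLp 2 (fun _ : ι => H) →L[ℂ] PiLp 2 (fun _ : ι => H),
      U = fun x => (eL.symm : (ι → H) →L[ℂ] PiLp 2 (fun _ : ι => H)) ∘L (ContinuousLinearMap.piMap fun i => V i x) ∘L
        (eL : PiLp 2 (fun _ : ι => H) →L[ℂ] (ι → H)) := ⟨_, rfl⟩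
  have hPap : ∀ (v : PiLp 2 (fun _ : ι => H)) (i : ι), (P v) i = Q i (v i) := fun v i => by
    rw [hP]
    simp only [ContinuousLinearMap.comp_apply, ContinuousLinearEquiv.coe_coe, heLa, heLs, PiLp.toLp_apply,
      ContinuousLinearMap.coe_piMap', Pi.map_apply]
  have hUap : ∀ (x : X) (v : PiLp 2 (fun _ : ι => H)) (i : ι), (U x v) i = V i x (v i) := fun x v i => by
    rw [hU]
    simp only [ContinuousLinearMap.comp_apply, ContinuousLinearEquiv.coe_coe, heLa, heLs, PiLp.toLp_apply,
      ContinuousLinearMap.coe_piMap', Pi.map_apply]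
  have hQVv : ∀ i x w, Q i (V i x w) = V i x (Q i w) := fun i x w => by
    have h := congrArg (fun T : H →L[ℂ] H => T w) (hQV i x)
    simpa only [mul_apply_eq_comp] using h
  -- norms and inner products are sums over the blocks
  have hnorm : ∀ v : PiLp 2 (fun _ : ι => H), ‖v‖ ^ 2 = ∑ i, ‖v i‖ ^ 2 := fun v => PiLp.norm_sq_eq_of_L2 _ v
  have hinner : ∀ v w : PiLp 2 (fun _ : ι => H), ⟪v, w⟫_ℂ = ∑ i, ⟪v i, w i⟫_ℂ := fun v w => PiLp.inner_apply v w
  -- powers act componentwise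
  have hpow : ∀ (n : ℕ) (v : PiLp 2 (fun _ : ι => H)) (i : ι), ((P ^ n) v) i = (Q i ^ n) (v i) := by
    intro n
    induction n with
    | zero => intro v i; simp
    | succ n ih =>
      intro v i
      rw [pow_succ', pow_succ', mul_apply_eq_comp, hPap, ih, mul_apply_eq_comp]
  refine ⟨P, U, ?_, ?_, ?_, ?_, ?_, ?_, ?_, ?_, fun n x Ψ i => by rw [hpow, hUap]⟩
  · -- self-adjoint
    rw [ContinuousLinearMap.isSelfAdjoint_iff_isSymmetric]
    intro v w
    simp only [ContinuousLinearMap.coe_coe, hinner, hPap]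
    refine Finset.sum_congr rfl fun i _ => ?_
    have h := (ContinuousLinearMap.isSelfAdjoint_iff_isSymmetric.1 (hQsa i)) (v i) (w i)
    simpa only [ContinuousLinearMap.coe_coe] using h
  · -- compact
    rw [hP]
    exact ((isCompactOperator_piMap Q hQc).comp_clm (eL : PiLp 2 (fun _ : ι => H) →L[ℂ] (ι → H))).clm_comp
      (eL.symm : (ι → H) →L[ℂ] PiLp 2 (fun _ : ι => H))
  · -- positive
    intro v
    rw [hinner, map_sum]
    exact Finset.sum_nonneg fun i _ => by rw [hPap]; exact hQpos i (v i)
  · -- contraction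
    intro v
    have h2 : ‖P v‖ ^ 2 ≤ ‖v‖ ^ 2 := by
      rw [hnorm, hnorm]
      exact Finset.sum_le_sum fun i _ => by
        rw [hPap]; exact pow_le_pow_left₀ (norm_nonneg _) (hQn i (v i)) 2
    exact (pow_le_pow_iff_left₀ (norm_nonneg _) (norm_nonneg _) two_ne_zero).1 h2
  · -- `U 0 = 1`
    ext v i
    rw [hUap, hV0, one_apply_eq_self, one_apply_eq_self]
  · -- `U (x + y) = U x * U y`
    intro x y; ext v i
    rw [hUap, hVadd, mul_apply_eq_comp, mul_apply_eq_comp, hUap, hUap]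
  · -- norm preserving
    intro x v
    have h2 : ‖U x v‖ ^ 2 = ‖v‖ ^ 2 := by
      rw [hnorm, hnorm]
      exact Finset.sum_congr rfl fun i _ => by rw [hUap, hVnorm]
    exact (pow_left_inj₀ (norm_nonneg _) (norm_nonneg _) two_ne_zero).1 h2
  · -- commutation
    intro x; ext v i
    rw [mul_apply_eq_comp, mul_apply_eq_comp, hPap, hUap, hUap, hPap, hQVv]

omit [CompleteSpace H] in
/-- **Norms of finite linear combinations split over the blocks**: if `P`, `U` act componentwise through `Q i`, `V i`, then
`‖Σ_a c_a • P^{n_a} (U (x_a) Ψ)‖² = Σ_i ‖Σ_a c_a • (Q i)^{n_a} (V i (x_a) (Ψ i))‖²`. [cite: ReedSimonI1980, §II.1] -/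
theorem norm_sq_sum_smul_blocks {X : Type*} {P : PiLp 2 (fun _ : ι => H) →L[ℂ] PiLp 2 (fun _ : ι => H)}
    {U : X → PiLp 2 (fun _ : ι => H) →L[ℂ] PiLp 2 (fun _ : ι => H)} {Q : ι → H →L[ℂ] H} {V : ι → X → H →L[ℂ] H}
    (h : ∀ (n : ℕ) (x : X) (Ψ : PiLp 2 (fun _ : ι => H)) (i : ι), ((P ^ n) (U x Ψ)) i = (Q i ^ n) (V i x (Ψ i)))
    {A : Type*} (s : Finset A) (c : A → ℂ) (n : A → ℕ) (x : A → X) (Ψ : PiLp 2 (fun _ : ι => H)) :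
    ‖∑ a ∈ s, c a • (P ^ n a) (U (x a) Ψ)‖ ^ 2 = ∑ i, ‖∑ a ∈ s, c a • (Q i ^ n a) (V i (x a) (Ψ i))‖ ^ 2 := by
  rw [PiLp.norm_sq_eq_of_L2]
  refine Finset.sum_congr rfl fun i _ => ?_
  congr 2
  rw [WithLp.ofLp_sum, Finset.sum_apply]
  refine Finset.sum_congr rfl fun a _ => ?_
  rw [WithLp.ofLp_smul, Pi.smul_apply]
  exact congrArg _ (h (n a) (x a) Ψ i)

/-! ## §3 The rank-one block -/

omit [CompleteSpace H] in
/-- The rank-one map `v ↦ ⟪u, v⟫ u` is a compact operator (it factors through `ℂ`). [cite: ReedSimonI1980, Thm VI.12] -/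
theorem isCompactOperator_rankOne (u : H) : IsCompactOperator ((innerSL ℂ u).smulRight u : H →L[ℂ] H) := by
  have h1 : IsCompactOperator (innerSL ℂ u : H →L[ℂ] ℂ) := isCompactOperator_of_locallyCompactSpace_dom _
  have h2 := h1.clm_comp (ContinuousLinearMap.toSpanSingleton ℂ u)
  have he : ((ContinuousLinearMap.toSpanSingleton ℂ u) ∘ (innerSL ℂ u : H →L[ℂ] ℂ) : H → H) =
      ((innerSL ℂ u).smulRight u : H →L[ℂ] H) := by
    funext v
    simp [ContinuousLinearMap.toSpanSingleton_apply, ContinuousLinearMap.smulRight_apply]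
  rw [← he]; exact h2

/-- ★ **The rank-one block**: for a unit vector `u`, `R v = ⟪u, v⟫ u` is self-adjoint, compact, positive, a contraction, fixes `u`
(hence `Rⁿ u = u`), and commutes with the trivial representation. [cite: ReedSimonI1980, §II.1] -/
theorem rankOne_block {u : H} (hu : ‖u‖ = 1) :
    IsSelfAdjoint ((innerSL ℂ u).smulRight u : H →L[ℂ] H) ∧ IsCompactOperator ((innerSL ℂ u).smulRight u : H →L[ℂ] H) ∧
    (∀ v, 0 ≤ RCLike.re ⟪((innerSL ℂ u).smulRight u : H →L[ℂ] H) v, v⟫_ℂ) ∧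
    (∀ v, ‖((innerSL ℂ u).smulRight u : H →L[ℂ] H) v‖ ≤ ‖v‖) ∧
    (∀ n : ℕ, (((innerSL ℂ u).smulRight u : H →L[ℂ] H) ^ n) u = u) := by
  refine ⟨MixtureAlgebra.rankOne_isSelfAdjoint u, isCompactOperator_rankOne u, fun v => ?_, fun v => ?_, fun n => ?_⟩
  · rw [MixtureAlgebra.rankOne_apply, inner_smul_left, RCLike.conj_mul, ← RCLike.ofReal_pow, RCLike.ofReal_re]
    positivity
  · rw [MixtureAlgebra.rankOne_apply, norm_smul, hu, mul_one]
    calc ‖⟪u, v⟫_ℂ‖ ≤ ‖u‖ * ‖v‖ := norm_inner_le_norm u v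
      _ = ‖v‖ := by rw [hu, one_mul]
  · induction n with
    | zero => simp
    | succ n ih => rw [pow_succ, mul_apply_eq_comp, MixtureAlgebra.rankOne_apply_self hu, ih]

end Summit.QuantumFields.YangMills.Theorems.OSData.BlockDiagonal

end
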